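import Mathlib
import Summits.MatrixMultiplication.Statement
import Summits.MatrixMultiplication.MatrixMultiplication.Theorems.GraphEquationsExactMembers

/-!
# Graph equations — exact members MODULO OSCULATION-NULL REMAINDERS (M19j)

`tensorRank_le_of_exactMembers` (M19i) reads only the `c_{q'}`- and `a_{ij}b_{j'l}`-coefficients of the
member identities at the base point `0`.  Hence the identities need only hold modulo remainders `r_q`
whose coefficients of these two kinds vanish — OSCULATION-NULL polynomials.  Two sources of such
remainders, both needed by the e-engine (NODE-g32 REV 7/8):

* `𝔪_{ab}·I`: `Σ_{q'} g_{q'} f_{q'}` with `g_{q'}(0) = 0` (`coeff_single_inr_sum_mul_generator`,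
  `coeff_ab_sum_mul_generator`) — this is how a coordinate `q` FORCED at a level (`e_q` in the row space
  of the `c`-Jacobian) is served by a CONSTANT combination of outputs: `Σ_o P_o p_o = f_q + r_q`;
* `I²` (`coeff_single_inr_eq_zero_of_mem_sq`, `coeff_ab_eq_zero_of_mem_sq`) — the tails of the Leibniz
  expansions.

* `tensorRank_le_of_exactMembers_mod` — M19i with `Σ_o h_o^{(q)} p_o = u_q f_q + r_q`, `r_q` osculation-null.
-/

set_option linter.dupNamespace false

noncomputable section

open scoped BigOperators

namespace Summit.MatrixMultiplication.MatrixMultiplication.Theorems.GraphEquations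

open MvPolynomial
open Literature.Computability.AlgebraicComplexity
open Literature.Computability.AlgebraicComplexity.ArithCircuit

variable {n : ℕ}

/-! ## Osculation-null remainders -/

/-- `𝔪_{ab}·I` has no `c`-linear terms: `coeff_{c_q}(Σ g_{q'} f_{q'}) = 0` if all `g_{q'}(0) = 0`. -/
theorem coeff_single_inr_sum_mul_generator (g : Fin n × Fin n → MvPolynomial (GraphVars n) ℂ)
    (hg : ∀ q', coeff 0 (g q') = 0) (q : Fin n × Fin n) :
    coeff (Finsupp.single (Sum.inr q : GraphVars n) 1) (∑ q', g q' * generator n q') = 0 := by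
  classical
  rw [coeff_sum]
  exact Finset.sum_eq_zero fun q' _ => by
    rw [coeff_single_one_mul, hg, coeff_zero_generator, zero_mul, mul_zero, add_zero]

/-- `𝔪_{ab}·I` has no `a ⊗ b` terms. -/
theorem coeff_ab_sum_mul_generator (g : Fin n × Fin n → MvPolynomial (GraphVars n) ℂ)
    (hg : ∀ q', coeff 0 (g q') = 0) (i j j' l : Fin n) :
    coeff (Finsupp.single (Sum.inl (Sum.inl (i, j)) : GraphVars n) 1 +
        Finsupp.single (Sum.inl (Sum.inr (j', l)) : GraphVars n) 1) (∑ q', g q' * generator n q') = 0 := by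
  classical
  have hvw : (Sum.inl (Sum.inl (i, j)) : GraphVars n) ≠ Sum.inl (Sum.inr (j', l)) := by simp
  rw [coeff_sum]
  exact Finset.sum_eq_zero fun q' _ => by
    rw [coeff_single_add_single_mul hvw, hg, coeff_zero_generator, coeff_single_inl_generator,
      coeff_single_inl_generator]
    ring

/-- `I²` has no `c`-linear terms. -/
theorem coeff_single_inr_eq_zero_of_mem_sq {r : MvPolynomial (GraphVars n) ℂ}
    (hr : r ∈ graphIdeal n ^ 2) (q : Fin n × Fin n) :
    coeff (Finsupp.single (Sum.inr q : GraphVars n) 1) r = 0 := by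
  rw [pow_two] at hr
  refine Submodule.mul_induction_on hr (fun f hf f' hf' => ?_) (fun x y hx hy => ?_)
  · rw [coeff_single_one_mul, coeff_zero_eq_zero_of_mem_graphIdeal hf,
      coeff_zero_eq_zero_of_mem_graphIdeal hf', zero_mul, mul_zero, add_zero]
  · rw [coeff_add, hx, hy, add_zero]

/-- `I²` has no `a ⊗ b` terms. -/
theorem coeff_ab_eq_zero_of_mem_sq {r : MvPolynomial (GraphVars n) ℂ} (hr : r ∈ graphIdeal n ^ 2)
    (i j j' l : Fin n) :
    coeff (Finsupp.single (Sum.inl (Sum.inl (i, j)) : GraphVars n) 1 +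
        Finsupp.single (Sum.inl (Sum.inr (j', l)) : GraphVars n) 1) r = 0 := by
  have hvw : (Sum.inl (Sum.inl (i, j)) : GraphVars n) ≠ Sum.inl (Sum.inr (j', l)) := by simp
  rw [pow_two] at hr
  refine Submodule.mul_induction_on hr (fun f hf f' hf' => ?_) (fun x y hx hy => ?_)
  · rw [coeff_single_add_single_mul hvw, coeff_zero_eq_zero_of_mem_graphIdeal hf,
      coeff_zero_eq_zero_of_mem_graphIdeal hf', coeff_single_inl_eq_zero_of_mem_graphIdeal hf (Sum.inl (i, j)),
      coeff_single_inl_eq_zero_of_mem_graphIdeal hf (Sum.inr (j', l))]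
    ring
  · rw [coeff_add, hx, hy, add_zero]

/-! ## The theorem modulo osculation-null remainders -/

/-- **EXACT UNIT MEMBERS MODULO OSCULATION-NULL REMAINDERS FORCE THE RANK BOUND.**  As
`tensorRank_le_of_exactMembers`, with identities `Σ_o h_o^{(q)} p_o = u_q f_q + r_q` where `r_q` has no
`c`-linear and no `a ⊗ b` terms (e.g. `r_q ∈ 𝔪_{ab}·I + I²`, by the lemmas above). -/
theorem tensorRank_le_of_exactMembers_mod {N : ℕ} {ο : Type*} [Fintype ο] [DecidableEq ο]
    (p : ο → MvPolynomial (GraphVars n) ℂ)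
    (hspan : ∃ gs : List (MvPolynomial (GraphVars n) ℂ), IsNonscalarSeq gs ∧ gs.length ≤ N ∧
      ∀ o, p o ∈ freeSpan {q | q ∈ gs})
    (h0 : ∀ o, coeff 0 (p o) = 0)
    (h1 : ∀ o (v : MatMulVars n), coeff (Finsupp.single (Sum.inl v : GraphVars n) 1) (p o) = 0)
    (h : Fin n × Fin n → ο → MvPolynomial (GraphVars n) ℂ)
    (u : Fin n × Fin n → MvPolynomial (GraphVars n) ℂ) (hu : ∀ q, coeff 0 (u q) ≠ 0)
    (r : Fin n × Fin n → MvPolynomial (GraphVars n) ℂ)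
    (hrc : ∀ q q' : Fin n × Fin n, coeff (Finsupp.single (Sum.inr q' : GraphVars n) 1) (r q) = 0)
    (hrab : ∀ (q : Fin n × Fin n) (i j j' l : Fin n),
      coeff (Finsupp.single (Sum.inl (Sum.inl (i, j)) : GraphVars n) 1 +
        Finsupp.single (Sum.inl (Sum.inr (j', l)) : GraphVars n) 1) (r q) = 0)
    (hmem : ∀ q, ∑ o, h q o * p o = u q * generator n q + r q) :
    tensorRank (matMulTensor ℂ n n n) ≤ 2 * N := by
  classical
  have hc : ∀ q q' : Fin n × Fin n,
      ∑ o, coeff 0 (h q o) * coeff (Finsupp.single (Sum.inr q' : GraphVars n) 1) (p o) =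
        coeff 0 (u q) * (if q = q' then 1 else 0) := by
    intro q q'
    have := congrArg (coeff (Finsupp.single (Sum.inr q' : GraphVars n) 1)) (hmem q)
    simpa only [coeff_sum, coeff_single_one_mul, h0, mul_zero, add_zero, coeff_zero_generator,
      coeff_inr_generator, coeff_add, hrc] using this
  have hab : ∀ (q : Fin n × Fin n) (i j j' l : Fin n),
      ∑ o, coeff 0 (h q o) * coeff (Finsupp.single (Sum.inl (Sum.inl (i, j)) : GraphVars n) 1 +
          Finsupp.single (Sum.inl (Sum.inr (j', l)) : GraphVars n) 1) (p o) =
        coeff 0 (u q) * -(if j = j' then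
          coeff (Finsupp.single (Sum.inr (i, l) : GraphVars n) 1) (generator n q) else 0) := by
    intro q i j j' l
    have hvw : (Sum.inl (Sum.inl (i, j)) : GraphVars n) ≠ Sum.inl (Sum.inr (j', l)) := by simp
    have := congrArg (coeff (Finsupp.single (Sum.inl (Sum.inl (i, j)) : GraphVars n) 1 +
      Finsupp.single (Sum.inl (Sum.inr (j', l)) : GraphVars n) 1)) (hmem q)
    simpa only [coeff_sum, coeff_single_add_single_mul hvw, h0, h1, mul_zero, add_zero,
      coeff_zero_generator, coeff_single_inl_generator, coeff_add, hrab,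
      coeffIdentity n (generator n q) (fun x hx => eval_generator_of_mem hx q) i j j' l] using this
  let cab : (Fin n × Fin n) × (Fin n × Fin n) → (GraphVars n →₀ ℕ) := fun r =>
    Finsupp.single (Sum.inl (Sum.inl r.1) : GraphVars n) 1 + Finsupp.single (Sum.inl (Sum.inr r.2)) 1
  let H : ο → (Fin n × Fin n) × (Fin n × Fin n) → ℂ := fun o r =>
    -(coeff (cab r) (p o) +
      if r.1.2 = r.2.1 then coeff (Finsupp.single (Sum.inr (r.1.1, r.2.2) : GraphVars n) 1) (p o) else 0)
  let M : (Fin n × Fin n) × (Fin n × Fin n) → Fin n × Fin n → Fin n × Fin n → ℂ := fun r a b =>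
    if r = (a, b) then 1 else 0
  let P : Fin n × Fin n → ο → ℂ := fun c o => coeff 0 (h c o) / coeff 0 (u c)
  refine tensorRank_le_of_oscId p hspan H M (fun o i j j' l => ?_) P (fun c q => ?_) (fun c r => ?_)
  · have hsum : ∑ r, H o r * M r (i, j) (j', l) = H o ((i, j), (j', l)) := by
      simp only [M, mul_ite, mul_one, mul_zero, Finset.sum_ite_eq', Finset.mem_univ, if_true]
    rw [hsum]
    simp only [H, cab]
    ring
  · have hdiv : ∑ o, P c o * coeff (Finsupp.single (Sum.inr q : GraphVars n) 1) (p o) =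
        (∑ o, coeff 0 (h c o) * coeff (Finsupp.single (Sum.inr q : GraphVars n) 1) (p o)) /
          coeff 0 (u c) := by
      rw [Finset.sum_div]
      exact Finset.sum_congr rfl fun o _ => by simp only [P]; ring
    rw [hdiv, hc, mul_div_cancel_left₀ _ (hu c)]
  · obtain ⟨⟨i, j⟩, ⟨j', l⟩⟩ := r
    have key : ∑ o, coeff 0 (h c o) * H o ((i, j), (j', l)) = 0 := by
      by_cases hjj : j = j'
      · subst hjj
        simp only [H, cab, if_true, mul_neg, mul_add, Finset.sum_neg_distrib,
          Finset.sum_add_distrib, hab, hc, coeff_inr_generator, neg_eq_zero]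
        ring
      · simp only [H, cab, hjj, if_false, add_zero, mul_neg, Finset.sum_neg_distrib, hab, mul_zero,
          neg_zero, mul_neg]
    have hdiv : ∑ o, P c o * H o ((i, j), (j', l)) =
        (∑ o, coeff 0 (h c o) * H o ((i, j), (j', l))) / coeff 0 (u c) := by
      rw [Finset.sum_div]
      exact Finset.sum_congr rfl fun o _ => by simp only [P]; ring
    rw [hdiv, key, zero_div]

/-- **Forced coordinates are served by the tests.**  If a CONSTANT combination of outputs equals
`f_q` modulo `𝔪_{ab}·I + I²` — `Σ_o P_o p_o = f_q + Σ_{q'} g_{q'} f_{q'} + s`, `g_{q'}(0) = 0`, `s ∈ I²` —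
then it is an exact unit member modulo an osculation-null remainder (`u_q = 1`). -/
theorem oscNull_of_forced (g : Fin n × Fin n → MvPolynomial (GraphVars n) ℂ) (hg : ∀ q', coeff 0 (g q') = 0)
    {s : MvPolynomial (GraphVars n) ℂ} (hs : s ∈ graphIdeal n ^ 2) :
    (∀ q' : Fin n × Fin n,
        coeff (Finsupp.single (Sum.inr q' : GraphVars n) 1) (∑ q'', g q'' * generator n q'' + s) = 0) ∧
      ∀ i j j' l : Fin n,
        coeff (Finsupp.single (Sum.inl (Sum.inl (i, j)) : GraphVars n) 1 +
          Finsupp.single (Sum.inl (Sum.inr (j', l)) : GraphVars n) 1) (∑ q'', g q'' * generator n q'' + s) = 0 :=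
  ⟨fun q' => by rw [coeff_add, coeff_single_inr_sum_mul_generator g hg, coeff_single_inr_eq_zero_of_mem_sq hs,
      add_zero],
    fun i j j' l => by rw [coeff_add, coeff_ab_sum_mul_generator g hg, coeff_ab_eq_zero_of_mem_sq hs, add_zero]⟩

end Summit.MatrixMultiplication.MatrixMultiplication.Theorems.GraphEquations

end
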